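import Summits.FinalStateConjecture.FinalStateConjecture.Statement
import Literature.Geometry.Lorentzian.ConvergenceTransport

/-!
# Solo (blind) — transport of causal structure and null infinity along isometries, II

Push-forward of an `N`-black-hole final state decomposition (`FinalStateDecomposition`) of a
region `O ⊆ M₁` along a smooth, time-orientation preserving, isometric open embedding
`Φ : (M₁, g₁) → (M₂, g₂)` (`SoloBlindEmbedding`) to one of `Φ(O)`, with the same parameters
`(N, Mᵢ, aᵢ, Λᵢ, cᵢ, τ₀, ρᵢ, U₀)` and the charts composed with `Φ` (`SoloBlindEmbedding.push`):
the `Cᵏ` deviations are unchanged (`Spacetime.deviation_comp`, `Φ^* g₂ = g₁`), the world-tubes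
stay disjoint, the covering clause is transported by `image_causalPast_subset`; and the two
chart clauses of the statement push forward with it — `HasExhaustiveCharts`
(`hasExhaustiveCharts_push`) and `IsFutureOriented` (`isFutureOriented_push`, chain rule and
O'Neill 1983, Ch. 5, p. 145). Used in `SoloBlindInvariance`.

References: B. O'Neill, *Semi-Riemannian geometry*, Academic Press 1983, Ch. 3, p. 58, Ch. 5,
p. 145, Ch. 14, p. 403; Dafermos–Holzegel–Rodnianski–Taylor, arXiv:2104.08222, §1 (the
deviation from Kerr); S. Klainerman, C. R. Mécanique 353 (2025), §1.1.1.
-/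

noncomputable section

open Literature.Geometry.Lorentzian TopologicalSpace Manifold Filter Topology Set Function
open scoped ContDiff Topology ENNReal Manifold

namespace Summit.FinalStateConjecture.FinalStateConjecture.Theorems

/-! ### D. Pushing a final state decomposition forward along an isometric open embedding -/

section Push

/-- A smooth, time-orientation preserving, isometric open embedding of `4`-dimensional
spacetimes `Φ : (M₁, g₁, τ₁) → (M₂, g₂, τ₂)`, `Φ^* g₂ = g₁` (the data of
`DataEmbedding.EmbedsInto` without the compatibility with the data embeddings). -/
structure SoloBlindEmbedding (𝓢₁ 𝓢₂ : Spacetime.{0} 4) where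
  /-- The underlying map. -/
  toFun : 𝓢₁.carrier → 𝓢₂.carrier
  /-- Smoothness. -/
  contMDiff : ContMDiff (𝓡 4) (𝓡 4) ∞ toFun
  /-- `Φ` is an open topological embedding. -/
  isOpenEmbedding : IsOpenEmbedding toFun
  /-- `Φ^* g₂ = g₁`. -/
  isIsometry : ∀ y, pullbackBilin (I := 𝓡 4) (I' := 𝓡 4) toFun 𝓢₂.metric.val y = 𝓢₁.metric.val y
  /-- `Φ` preserves the time orientations. -/
  preserves : 𝓢₁.timeOrientation.PreservesTimeOrientation toFun 𝓢₂.timeOrientation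

namespace SoloBlindEmbedding

variable {𝓢₁ 𝓢₂ : Spacetime.{0} 4} (Φ : SoloBlindEmbedding 𝓢₁ 𝓢₂)

/-- `Φ` is differentiable. -/
theorem mdifferentiable : MDifferentiable (𝓡 4) (𝓡 4) Φ.toFun :=
  Φ.contMDiff.mdifferentiable (by simp)

/-- `Φ` is injective. -/
theorem injective : Injective Φ.toFun := Φ.isOpenEmbedding.injective

/-- Late-time charts push forward along `Φ` (smoothness and open embeddings compose). -/
theorem isLateChart_comp {B : ModelBackground} {𝒪 : Set 𝓢₁.carrier} {τ₀ : ℝ}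
    {Ψ : B.domain → 𝓢₁.carrier} (h : 𝓢₁.IsLateChart B 𝒪 τ₀ Ψ) :
    𝓢₂.IsLateChart B (Φ.toFun '' 𝒪) τ₀ (Φ.toFun ∘ Ψ) where
  contMDiff := Φ.contMDiff.comp h.contMDiff
  isOpenEmbedding := Φ.isOpenEmbedding.comp h.isOpenEmbedding
  image_subset := by
    rw [image_comp]
    exact image_mono h.image_subset

/-- The `Cᵏ` slab deviation of a chart is invariant under composition with `Φ`
(`Spacetime.deviation_comp`; O'Neill 1983, Ch. 3, p. 58). -/
theorem deviationCk_comp (B : ModelBackground) {Ψ : B.domain → 𝓢₁.carrier}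
    (hΨ : ContMDiff 𝓘(ℝ, E4) (𝓡 4) ∞ Ψ) (k : ℕ) (τ : ℝ) :
    𝓢₂.deviationCk B (Φ.toFun ∘ Ψ) k τ = 𝓢₁.deviationCk B Ψ k τ := by
  unfold Spacetime.deviationCk Spacetime.deviationExtend
  rw [Spacetime.deviation_comp B Φ.mdifferentiable Φ.isIsometry (hΨ.mdifferentiable (by simp))]

/-- The truncated `Cᵏ` slab deviation of a chart is invariant under composition with `Φ`. -/
theorem truncDeviationCk_comp (B : ModelBackground) {Ψ : B.domain → 𝓢₁.carrier}
    (hΨ : ContMDiff 𝓘(ℝ, E4) (𝓡 4) ∞ Ψ) (k : ℕ) (R τ : ℝ) :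
    𝓢₂.truncDeviationCk B (Φ.toFun ∘ Ψ) k R τ = 𝓢₁.truncDeviationCk B Ψ k R τ := by
  unfold Spacetime.truncDeviationCk Spacetime.deviationExtend
  rw [Spacetime.deviation_comp B Φ.mdifferentiable Φ.isIsometry (hΨ.mdifferentiable (by simp))]

/-- Covering clauses push forward: `Φ(O) ∖ Φ(A) ⊆ J⁻(Φ(S))` if `O ∖ A ⊆ J⁻(S)`
(`image_causalPast_subset`, O'Neill 1983, Ch. 14, p. 403). -/
theorem image_diff_subset_causalPast {O A S : Set 𝓢₁.carrier}
    (h : O \ A ⊆ 𝓢₁.metric.causalPast 𝓢₁.timeOrientation S) :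
    Φ.toFun '' O \ Φ.toFun '' A ⊆ 𝓢₂.metric.causalPast 𝓢₂.timeOrientation (Φ.toFun '' S) := by
  rw [← image_sdiff Φ.injective]
  exact (image_mono h).trans
    (LorentzianMetric.image_causalPast_subset Φ.mdifferentiable Φ.preserves Φ.isIsometry S)

variable {O : Set 𝓢₁.carrier} {k : ℕ}

/-- **Push-forward of an `N`-black-hole final state decomposition** of the region `O ⊆ M₁`
along `Φ` to one of `Φ(O) ⊆ M₂`: the same parameters `(N, Mᵢ, aᵢ, Λᵢ, cᵢ, τ₀, ρᵢ, U₀)` with the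
charts `Φ ∘ chartᵢ`, `Φ ∘ flatChart`; the deviations are unchanged (`Φ^* g₂ = g₁`), the
world-tubes stay disjoint (`Φ` injective) and the covering clause is transported by
`image_causalPast_subset`. -/
def push (d : FinalStateDecomposition 𝓢₁ O k) : FinalStateDecomposition 𝓢₂ (Φ.toFun '' O) k where
  N := d.N
  mass := d.mass
  spin := d.spin
  mass_pos := d.mass_pos
  abs_spin_le_mass := d.abs_spin_le_mass
  motion := d.motion
  τ₀ := d.τ₀
  chart i := Φ.toFun ∘ d.chart i
  isLateChart i := Φ.isLateChart_comp (d.isLateChart i)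
  tendsto_truncDeviationCk i R :=
    (d.tendsto_truncDeviationCk i R).congr fun τ ↦
      (Φ.truncDeviationCk_comp _ (d.isLateChart i).contMDiff k R τ).symm
  exists_pairwise_disjoint R := by
    obtain ⟨τ₁, h⟩ := d.exists_pairwise_disjoint R
    refine ⟨τ₁, fun i j hij ↦ ?_⟩
    have hd : Disjoint (d.chart i '' _) (d.chart j '' _) := h hij
    show Disjoint ((Φ.toFun ∘ d.chart i) '' _) ((Φ.toFun ∘ d.chart j) '' _)
    rw [image_comp, image_comp]
    exact (disjoint_image_iff Φ.injective).2 hd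
  excision := d.excision
  tendsto_excision_div := d.tendsto_excision_div
  flatDomain := d.flatDomain
  setOf_lt_excision_subset_flatDomain := d.setOf_lt_excision_subset_flatDomain
  flatChart := Φ.toFun ∘ d.flatChart
  isLateChart_flat := Φ.isLateChart_comp d.isLateChart_flat
  tendsto_deviationCk_flat :=
    d.tendsto_deviationCk_flat.congr fun τ ↦
      (Φ.deviationCk_comp _ d.isLateChart_flat.contMDiff k τ).symm
  diff_subset_causalPast := by
    have h := Φ.image_diff_subset_causalPast d.diff_subset_causalPast
    simpa only [image_union, image_iUnion, ← image_comp] using h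

variable (d : FinalStateDecomposition 𝓢₁ O k)

/-- Same number of holes. -/
@[simp] theorem push_N : (Φ.push d).N = d.N := rfl
/-- Same masses. -/
@[simp] theorem push_mass : (Φ.push d).mass = d.mass := rfl
/-- Same spins. -/
@[simp] theorem push_spin : (Φ.push d).spin = d.spin := rfl
/-- Same asymptotic motions. -/
@[simp] theorem push_motion : (Φ.push d).motion = d.motion := rfl
/-- Same initial late time. -/
@[simp] theorem push_τ₀ : (Φ.push d).τ₀ = d.τ₀ := rfl
/-- Same excision radii. -/
@[simp] theorem push_excision : (Φ.push d).excision = d.excision := rfl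
/-- Same flat domain. -/
@[simp] theorem push_flatDomain : (Φ.push d).flatDomain = d.flatDomain := rfl
/-- The hole charts are composed with `Φ`. -/
theorem push_chart (i : Fin d.N) : (Φ.push d).chart i = Φ.toFun ∘ d.chart i := rfl
/-- The flat chart is composed with `Φ`. -/
theorem push_flatChart : (Φ.push d).flatChart = Φ.toFun ∘ d.flatChart := rfl
/-- Same reference backgrounds. -/
theorem push_background (i : Fin d.N) : (Φ.push d).background i = d.background i := rfl

/-- The charted late region of the push-forward is the image of the charted late region. -/
theorem push_charted : (Φ.push d).charted = Φ.toFun '' d.charted := by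
  show (Φ.toFun ∘ d.flatChart) '' _ ∪ ⋃ i, (Φ.toFun ∘ d.chart i) '' _ =
    Φ.toFun '' (d.flatChart '' _ ∪ ⋃ i, d.chart i '' _)
  simp only [image_union, image_iUnion, image_comp]
  rfl

/-- `certifiedLate` of the push-forward is the image of `certifiedLate`. -/
theorem push_certifiedLate (R : Fin d.N → ℝ → ℝ) (τ₁ : ℝ) :
    certifiedLate (Φ.push d) R τ₁ = Φ.toFun '' certifiedLate d R τ₁ := by
  show (Φ.toFun ∘ d.flatChart) '' _ ∪ ⋃ i, (Φ.toFun ∘ d.chart i) '' _ =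
    Φ.toFun '' (d.flatChart '' _ ∪ ⋃ i, d.chart i '' _)
  simp only [image_union, image_iUnion, image_comp]
  rfl

/-- `certifiedSlab` of the push-forward is the image of `certifiedSlab`. -/
theorem push_certifiedSlab (R : Fin d.N → ℝ → ℝ) (τ₁ : ℝ) :
    certifiedSlab (Φ.push d) R τ₁ = Φ.toFun '' certifiedSlab d R τ₁ := by
  show (Φ.toFun ∘ d.flatChart) '' _ ∪ ⋃ i, (Φ.toFun ∘ d.chart i) '' _ =
    Φ.toFun '' (d.flatChart '' _ ∪ ⋃ i, d.chart i '' _)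
  simp only [image_union, image_iUnion, image_comp]
  rfl

variable {d}

/-- **`HasExhaustiveCharts` pushes forward** (same radius functions `Rᵢ`; the truncated
deviations are unchanged and the covering clause is transported by `image_causalPast_subset`). -/
theorem hasExhaustiveCharts_push (h : HasExhaustiveCharts d) : HasExhaustiveCharts (Φ.push d) := by
  obtain ⟨R, hR, hdev, hcov⟩ := h
  refine ⟨R, hR, fun i ↦ (hdev i).congr fun τ ↦
    (Φ.truncDeviationCk_comp _ (d.isLateChart i).contMDiff k (R i τ) τ).symm, fun τ₁ hτ₁ ↦ ?_⟩
  rw [push_certifiedLate, push_certifiedSlab]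
  exact Φ.image_diff_subset_causalPast (hcov τ₁ hτ₁)

/-- **`IsFutureOriented` pushes forward** (chain rule `d(Φ ∘ χ) = dΦ ∘ dχ` and `dΦ` maps
future-directed causal vectors to future-directed causal vectors, O'Neill 1983, Ch. 5, p. 145). -/
theorem isFutureOriented_push (h : IsFutureOriented d) : IsFutureOriented (Φ.push d) := by
  obtain ⟨horth, hK, hflat⟩ := h
  refine ⟨horth, fun (i : Fin d.N) ρ ↦ ?_, ?_⟩
  · show ∀ᶠ τ in atTop,
      ∀ x : boostedKerrExterior (d.motion i).1 (d.motion i).2 (d.mass i) (d.spin i),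
        x ∈ (d.background i).truncTimeSlab ρ τ →
          𝓢₂.timeOrientation.IsFutureDirected (mfderiv 𝓘(ℝ, E4) (𝓡 4) (Φ.toFun ∘ d.chart i) x
            (((d.motion i).1 : E4 ≃L[ℝ] E4) (Kerr.timeVector (d.mass i) (d.spin i)
              (poincareInv (d.motion i).1 (d.motion i).2 (x : E4)))))
    have hχ : MDifferentiable 𝓘(ℝ, E4) (𝓡 4) (d.chart i) :=
      (d.isLateChart i).contMDiff.mdifferentiable (by simp)
    filter_upwards [hK i ρ] with τ hτ x hx
    rw [mfderiv_comp x (Φ.mdifferentiable _) (hχ x)]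
    exact Φ.preserves.isFutureDirected_mfderiv Φ.isIsometry (hτ x hx)
  · show ∀ᶠ τ in atTop, ∀ x : d.flatDomain, x ∈ (Minkowski.backgroundOn d.flatDomain).timeSlab τ →
      𝓢₂.timeOrientation.IsFutureDirected
        (mfderiv 𝓘(ℝ, E4) (𝓡 4) (Φ.toFun ∘ d.flatChart) x (E4.basisVector 0))
    have hχ : MDifferentiable 𝓘(ℝ, E4) (𝓡 4) d.flatChart :=
      d.isLateChart_flat.contMDiff.mdifferentiable (by simp)
    filter_upwards [hflat] with τ hτ x hx
    rw [mfderiv_comp x (Φ.mdifferentiable _) (hχ x)]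
    exact Φ.preserves.isFutureDirected_mfderiv Φ.isIsometry (hτ x hx)

end SoloBlindEmbedding

end Push

end Summit.FinalStateConjecture.FinalStateConjecture.Theorems

end
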